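import Summits.ResolutionOfSingularities.KangarooAtlas.MizutaniRationalPoints
import Summits.ResolutionOfSingularities.KangarooAtlas.MizutaniSpecialization
import Mathlib.RingTheory.MvPolynomial.Expand
import HarnessLib

/-!
# The `q`-linear generization of a point: the Hironaka scheme only depends on the `k`-linear hull of `[ξ^q]`

Cell `pub-rosobs`, Mizutani enclosure (seat mizutani-encloser-1, gen 8).  AI-written; *AI review is weaker than
expert review*; NOT a resolution-of-singularities theorem (summit relevance C).

Mizutani 1973 §1 (d) calls `𝔭` «the most generic point associated with an H-scheme `B`» when `B(𝔭) = B` and every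
`𝔶` with `B(𝔶) = B` specialises from `𝔭`; Thm. 1.3 (= Oda 1973 Thm. 2.5) asserts that such a point exists and is cut
out by `q`-th power forms (`γ(𝒥_e𝒟_e(N_e)·S)`), and T. Oda's versal family (1983-II Thm. 3.1) writes every scheme
`B(𝔭)` as `Φ^{(1)}(L_0, φ)` for a LINEAR map `φ`.  This file proves an intrinsic statement of that kind in the
tree's vocabulary (`invForms`, `ExponentLE`, `exponent`, `bIdeal = U_+(𝔭)S`), without `𝒥`/`𝒟`:

for a point `𝔭` of `ℙ^n_k` (`ξ_i` the class of `X_i` in `S/𝔭`) and a level `e`, `q = p^e`, let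
`V_e(𝔭) = {g ∈ k^{n+1} : Σ g_i X_i^q ∈ 𝔭}` (the additive forms of level `e` through the point, `pointForms`),
`𝔩_e(𝔭) = (Σ g_i X_i : g ∈ V_e(𝔭))` — a prime generated by LINEAR forms, the ideal of the `k`-linear hull `Λ_e` of
the point `[ξ_0^q : ⋯ : ξ_n^q]` (`linHullIdeal`) — and

  `𝔮_e(𝔭) := {f : f^{(F^e)} ∈ 𝔩_e(𝔭)}` (`frobGen`; `f^{(F^e)}` = `F^e` applied to the coefficients),

the generic point of the preimage of `Λ_e` under the `k`-linear Frobenius `x ↦ x^q` of `ℙ^n` — a homogeneous prime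
with `𝔮_e(𝔭) ⊆ 𝔭` (`frobGen_le`: `f^{(F^e)} ∈ 𝔩_e ⇒ f^q = f^{(F^e)}(X^q) ∈ (Σ g_i X_i^q : g ∈ V_e) ⊆ 𝔭`).  THEN:

* **`invForms_frobGen_eq`** — if `exponent B(𝔭) ≤ e` then `(L_B)_j(𝔮_e(𝔭)) = (L_B)_j(𝔭)` for EVERY level `j`
  (levels `j ≤ e`: an additive form of level `j` through `𝔭` lies in `𝔮_e(𝔭)`, `addForm_mem_frobGen`; levels `j > e`:
  `F`-stability and `ExponentLE`);
* hence **`bIdeal_frobGen_eq`** `U_+(𝔮_e(𝔭))S = U_+(𝔭)S` — THE SAME HIRONAKA SCHEME `B_{P,𝔮_e(𝔭)} = B_{P,𝔭}` —,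
  `exponent_frobGen_eq`, `hsDim_frobGen_eq`, `isPoint_frobGen`: every Hironaka scheme of exponent `≤ e` is the scheme
  of a `q`-LINEAR point (one whose ideal is the Frobenius pull-back of an ideal of linear forms), and `B(𝔭)` depends
  only on the `k`-linear hull of `[ξ^q]` for any `q = p^e ≥ p^{exponent}`.  At `e = 0` this is the vector-group case
  (`𝔮_0(𝔭)` = generic point of the linear hull of `𝔭`); for a `k^{1/q}`-rational point `𝔮_e(𝔭) = 𝔭`.

## References

* H. Mizutani, *Hironaka's additive group schemes*, Nagoya Math. J. 52 (1973) 85–95, §1 (d) and Thm. 1.3.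
  [Mizutani1973HironakaGroupSchemes]
* T. Oda, *Hironaka's additive group scheme, II*, Publ. RIMS 19 (1983), Cor. 2.3 (p. 1171), Thm. 3.1 (p. 1173: "a versal
  family"). [Oda1983HironakaGroupSchemeII]
-/

noncomputable section

open MvPolynomial Literature.AlgebraicGeometry.Resolution Literature.AlgebraicGeometry.Resolution.HironakaScheme
  Literature.RingTheory.MvPolynomial Literature.RingTheory.HilbertSamuel

namespace Summit.ResolutionOfSingularities.KangarooAtlas.Mizutani

universe u

section FrobGen

variable (k : Type u) [Field k] (p : ℕ) [hp : Fact p.Prime] [CharP k p] {n : ℕ}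
  (𝔭 : Ideal (MvPolynomial (Fin (n + 1)) k)) (e : ℕ)

/-- **`V_e(𝔭)`: the coefficient vectors `g` of the additive forms `Σ g_i X_i^{p^e}` of level `e` lying in `𝔭`** (all of
them, invariant or not), a `k`-subspace of `k^{n+1}`. [cite: Mizutani1973HironakaGroupSchemes, §1 (a) (L_e, the purely inseparable forms of degree p^e) and Thm. 1.3] -/
noncomputable def pointForms : Submodule k (Fin (n + 1) → k) :=
  (Submodule.restrictScalars k 𝔭).comap (addFormLin k p e)

omit hp [CharP k p] in
/-- Membership in `V_e(𝔭)`. [folklore] -/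
theorem mem_pointForms_iff {g : Fin (n + 1) → k} : g ∈ pointForms k p 𝔭 e ↔ addForm k p e g ∈ 𝔭 := by
  unfold pointForms
  rw [Submodule.mem_comap, addFormLin_apply, Submodule.restrictScalars_mem]

/-- **`𝔩_e(𝔭)`: the ideal generated by the LINEAR forms `Σ g_i X_i`, `g ∈ V_e(𝔭)`** — the ideal of the `k`-linear hull
`Λ_e` of the point `[ξ_0^q : ⋯ : ξ_n^q]`. [cite: Oda1983HironakaGroupSchemeII, Thm. 3.1 (p. 1173: the linear map φ)] -/
noncomputable def linHullIdeal : Ideal (MvPolynomial (Fin (n + 1)) k) :=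
  Ideal.span (linForm '' (pointForms k p 𝔭 e : Set (Fin (n + 1) → k)))

/-- **`𝔮_e(𝔭)`, the `q`-LINEAR GENERIZATION of `𝔭`**: the polynomials `f` whose coefficient-twist `f^{(F^e)}` lies in
`𝔩_e(𝔭)` — the generic point of the preimage of `Λ_e` under the `k`-linear Frobenius `x ↦ x^{p^e}` of `ℙ^n`.
[cite: Mizutani1973HironakaGroupSchemes, §1 (d) ("the most generic point associated with an H-scheme") and Thm. 1.3] -/
noncomputable def frobGen : Ideal (MvPolynomial (Fin (n + 1)) k) :=
  (linHullIdeal k p 𝔭 e).comap (MvPolynomial.map (iterateFrobenius k p e))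

omit hp [CharP k p] in
/-- `𝔩_e(𝔭)` is prime (generated by linear forms). [folklore] -/
theorem isPrime_linHullIdeal : (linHullIdeal k p 𝔭 e).IsPrime := by
  unfold linHullIdeal
  exact isPrime_span_linForm _

/-- `𝔮_e(𝔭)` is prime. [folklore] -/
theorem isPrime_frobGen : (frobGen k p 𝔭 e).IsPrime := by
  haveI := isPrime_linHullIdeal k p 𝔭 e
  unfold frobGen
  exact Ideal.comap_isPrime _ _

/-- Membership in `𝔮_e(𝔭)`. [folklore] -/
theorem mem_frobGen_iff {f : MvPolynomial (Fin (n + 1)) k} :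
    f ∈ frobGen k p 𝔭 e ↔ MvPolynomial.map (iterateFrobenius k p e) f ∈ linHullIdeal k p 𝔭 e := Ideal.mem_comap

/-- `f^{(F^e)}(X^q) = f^q` (`q = p^e`): the `k`-linear Frobenius. [folklore] -/
theorem expand_map_iterateFrobenius (f : MvPolynomial (Fin (n + 1)) k) :
    expand (p ^ e) (MvPolynomial.map (iterateFrobenius k p e) f) = f ^ p ^ e := by
  rw [← map_expand, map_iterateFrobenius_expand]

omit hp [CharP k p] in
/-- `(Σ h_i X_i)(X^q) = Σ h_i X_i^q`: expanding a linear form gives the additive form. [folklore] -/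
theorem expand_linForm_eq_addForm (h : Fin (n + 1) → k) : expand (p ^ e) (linForm h) = addForm k p e h := by
  rw [expand_linForm, addForm_eq_powForm]

/-- **`𝔮_e(𝔭) ⊆ 𝔭`**: if `f^{(F^e)} ∈ 𝔩_e` then `f^q = f^{(F^e)}(X^q)` lies in the ideal generated by the additive forms
`Σ g_i X_i^q`, `g ∈ V_e(𝔭)`, which lie in `𝔭`; `𝔭` is prime. [cite: Mizutani1973HironakaGroupSchemes, §1 (d)] -/
theorem frobGen_le [𝔭.IsPrime] : frobGen k p 𝔭 e ≤ 𝔭 := by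
  intro f hf
  rw [mem_frobGen_iff] at hf
  have hmap : (linHullIdeal k p 𝔭 e).map
      ((expand (p ^ e) : MvPolynomial (Fin (n + 1)) k →ₐ[k] MvPolynomial (Fin (n + 1)) k) :
        MvPolynomial (Fin (n + 1)) k →+* MvPolynomial (Fin (n + 1)) k) ≤ 𝔭 := by
    unfold linHullIdeal
    rw [Ideal.map_span, Ideal.span_le]
    rintro _ ⟨_, ⟨g, hg, rfl⟩, rfl⟩
    rw [SetLike.mem_coe, RingHom.coe_coe, expand_linForm_eq_addForm]
    exact (mem_pointForms_iff k p 𝔭 e).mp hg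
  have h := hmap (Ideal.mem_map_of_mem _ hf)
  rw [RingHom.coe_coe, expand_map_iterateFrobenius] at h
  exact Ideal.IsPrime.mem_of_pow_mem inferInstance _ h

/-- `(Σ g_i X_i^{p^j})^{(F^e)} = Σ g_i^{p^e} X_i^{p^j}`. [folklore] -/
theorem map_iterateFrobenius_addForm (j : ℕ) (g : Fin (n + 1) → k) :
    MvPolynomial.map (iterateFrobenius k p e) (addForm k p j g) = addForm k p j (frobVec k p e g) := by
  unfold addForm frobVec
  rw [map_sum]
  refine Finset.sum_congr rfl fun i _ => ?_
  rw [map_mul, map_pow, map_C, map_X, iterateFrobenius_def]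

omit hp [CharP k p] in
/-- `Σ h_i X_i = Σ h_i X_i^{p^0}`: a linear form is the additive form of level `0`. [folklore] -/
theorem linForm_eq_addForm_zero (h : Fin (n + 1) → k) : linForm h = addForm k p 0 h := by
  rw [linForm_apply]
  unfold addForm
  exact Finset.sum_congr rfl fun i _ => by rw [pow_zero, pow_one, smul_eq_C_mul]

/-- **An additive form of level `j ≤ e` through `𝔭` lies in `𝔮_e(𝔭)`**: `(Σ g_i X_i^{p^j})^{(F^e)} = (Σ g_i^{p^{e−j}} X_i)^{p^j}`
and `F^{e−j} g ∈ V_e(𝔭)` (`(Σ g_i X_i^{p^j})^{p^{e−j}} = Σ g_i^{p^{e−j}} X_i^{p^e} ∈ 𝔭`).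
[cite: Mizutani1973HironakaGroupSchemes, Thm. 1.3 (N = rad_L(k[F] N_e))] -/
theorem addForm_mem_frobGen {j : ℕ} (hj : j ≤ e) {g : Fin (n + 1) → k} (hg : addForm k p j g ∈ 𝔭) :
    addForm k p j g ∈ frobGen k p 𝔭 e := by
  rw [mem_frobGen_iff, map_iterateFrobenius_addForm]
  -- `F^e g = F^j (F^{e−j} g)` and `addForm j (F^j h) = (linForm h)^{p^j}`
  set h : Fin (n + 1) → k := frobVec k p (e - j) g with hh
  have hF : frobVec k p e g = frobVec k p j h := by
    rw [hh, frobVec_frobVec]; congr 1; omega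
  have hpow : addForm k p j (frobVec k p j h) = linForm h ^ p ^ j := by
    rw [linForm_eq_addForm_zero k p, addForm_pow_pow, Nat.zero_add]
  rw [hF, hpow]
  -- `h ∈ V_e(𝔭)`
  have hmem : h ∈ pointForms k p 𝔭 e := by
    rw [mem_pointForms_iff, hh]
    have := Ideal.pow_mem_of_mem 𝔭 hg (p ^ (e - j)) (Nat.one_le_pow _ _ hp.out.pos)
    rw [addForm_pow_pow] at this
    convert this using 2
    omega
  have hgen : linForm h ∈ linHullIdeal k p 𝔭 e := Ideal.subset_span ⟨h, hmem, rfl⟩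
  rcases Nat.eq_zero_or_pos (p ^ j) with h0 | hpos
  · exact absurd h0 (pow_ne_zero _ hp.out.ne_zero)
  · exact Ideal.pow_mem_of_mem _ hgen _ hpos

/-- At `e = 0` the twist is trivial: `𝔮_0(𝔭) = 𝔩_0(𝔭)` is the generic point of the LINEAR hull of `𝔭` (the ideal
generated by the linear forms in `𝔭`) — the vector-group case. [cite: Mizutani1973HironakaGroupSchemes, Rem. 1.2 and §1 (d)] -/
theorem frobGen_zero : frobGen k p 𝔭 0 = linHullIdeal k p 𝔭 0 := by
  ext f
  rw [mem_frobGen_iff]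
  have hf : MvPolynomial.map (iterateFrobenius k p 0) f = f := by
    refine MvPolynomial.ext _ _ fun m => ?_
    rw [coeff_map, iterateFrobenius_def, pow_zero, pow_one]
  rw [hf]

/-- **The generizations increase with the level**: `𝔮_e(𝔭) ⊆ 𝔮_{e+1}(𝔭)` (`F V_e(𝔭) ⊆ V_{e+1}(𝔭)`), so
`𝔮_0(𝔭) ⊆ 𝔮_1(𝔭) ⊆ ⋯ ⊆ 𝔭`. [cite: Mizutani1973HironakaGroupSchemes, §1 (d)] -/
theorem frobGen_le_succ : frobGen k p 𝔭 e ≤ frobGen k p 𝔭 (e + 1) := by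
  intro f hf
  rw [mem_frobGen_iff] at hf ⊢
  have hcomm : iterateFrobenius k p (e + 1) = (iterateFrobenius k p 1).comp (iterateFrobenius k p e) := by
    rw [add_comm, iterateFrobenius_add]
  rw [hcomm, ← MvPolynomial.map_map]
  have hle : (linHullIdeal k p 𝔭 e).map (MvPolynomial.map (iterateFrobenius k p 1)) ≤ linHullIdeal k p 𝔭 (e + 1) := by
    unfold linHullIdeal
    rw [Ideal.map_span, Ideal.span_le]
    rintro _ ⟨_, ⟨g, hg, rfl⟩, rfl⟩
    have hmap : MvPolynomial.map (iterateFrobenius k p 1) (linForm g) = linForm (frobVec k p 1 g) := by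
      rw [linForm_eq_addForm_zero k p, map_iterateFrobenius_addForm, ← linForm_eq_addForm_zero k p]
    rw [SetLike.mem_coe, hmap]
    refine Ideal.subset_span ⟨frobVec k p 1 g, ?_, rfl⟩
    rw [SetLike.mem_coe, mem_pointForms_iff, ← addForm_pow_pow, pow_one]
    exact Ideal.pow_mem_of_mem 𝔭 ((mem_pointForms_iff k p 𝔭 e).mp hg) p hp.out.pos
  exact hle (Ideal.mem_map_of_mem _ hf)

/-- **`(L_B)_j(𝔭) ⊆ (L_B)_j(𝔮_e(𝔭))` for `j ≤ e`** (no exponent hypothesis).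
[cite: Oda1983HironakaGroupSchemeII, §2 (p. 1168) and Thm. 3.1] -/
theorem invForms_le_invForms_frobGen {j : ℕ} (hj : j ≤ e) : invForms k p 𝔭 j ≤ invForms k p (frobGen k p 𝔭 e) j :=
  fun _ ha D hD => addForm_mem_frobGen k p 𝔭 e hj (ha D hD)

/-- **THE `q`-LINEAR GENERIZATION HAS THE SAME INVARIANT FORMS**: if `exponent B(𝔭) ≤ e` (`ExponentLE k p 𝔭 e`), then
`(L_B)_j(𝔮_e(𝔭)) = (L_B)_j(𝔭)` for every level `j`. [cite: Mizutani1973HironakaGroupSchemes, §1 (d) and Thm. 1.3; Oda1983HironakaGroupSchemeII, Thm. 3.1 (p. 1173)] -/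
theorem invForms_frobGen_eq [𝔭.IsPrime] (hE : ExponentLE k p 𝔭 e) (j : ℕ) :
    invForms k p (frobGen k p 𝔭 e) j = invForms k p 𝔭 j := by
  apply le_antisymm (invForms_mono k p (frobGen_le k p 𝔭 e) j)
  rcases le_or_gt j e with hj | hj
  · exact invForms_le_invForms_frobGen k p 𝔭 e hj
  · obtain ⟨m, rfl⟩ := Nat.exists_eq_add_of_lt hj
    rw [show e + m + 1 = e + (m + 1) from rfl, hE (e + (m + 1)) (Nat.le_add_right _ _), Nat.add_sub_cancel_left]
    calc Submodule.span k (frobVec k p (m + 1) '' (invForms k p 𝔭 e : Set (Fin (n + 1) → k)))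
        ≤ Submodule.span k (frobVec k p (m + 1) '' (invForms k p (frobGen k p 𝔭 e) e : Set (Fin (n + 1) → k))) :=
          Submodule.span_mono (Set.image_mono (invForms_le_invForms_frobGen k p 𝔭 e le_rfl))
      _ ≤ invForms k p (frobGen k p 𝔭 e) (e + (m + 1)) := span_frobVec_pow_image_le k p _ e (m + 1)

/-- `ExponentLE` transfers (the condition only involves the invariant forms). [folklore] -/
theorem exponentLE_frobGen_iff [𝔭.IsPrime] (hE : ExponentLE k p 𝔭 e) (e' : ℕ) :
    ExponentLE k p (frobGen k p 𝔭 e) e' ↔ ExponentLE k p 𝔭 e' := by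
  unfold ExponentLE
  simp_rw [invForms_frobGen_eq k p 𝔭 e hE]

/-- **Same exponent.** [cite: Mizutani1973HironakaGroupSchemes, §1 (d)] -/
theorem exponent_frobGen_eq [𝔭.IsPrime] (hE : ExponentLE k p 𝔭 e) :
    exponent k p (frobGen k p 𝔭 e) = exponent k p 𝔭 := by
  unfold exponent
  congr 1
  ext e'
  exact exponentLE_frobGen_iff k p 𝔭 e hE e'

/-- **Same dimension.** [cite: Mizutani1973HironakaGroupSchemes, §1 (d) and Thm. 1.3] -/
theorem hsDim_frobGen_eq [𝔭.IsPrime] (hE : ExponentLE k p 𝔭 e) :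
    hsDim k p (frobGen k p 𝔭 e) = hsDim k p 𝔭 := by
  unfold hsDim hsDimAt
  rw [exponent_frobGen_eq k p 𝔭 e hE, invForms_frobGen_eq k p 𝔭 e hE]

/-- Homogeneous components commute with a change of coefficients (local copy of the Hironaka2017 library lemma). [folklore] -/
private theorem homogeneousComponent_map' {R S : Type*} [CommRing R] [CommRing S] (f : R →+* S) (a : ℕ)
    (G : MvPolynomial (Fin (n + 1)) R) :
    homogeneousComponent a (MvPolynomial.map f G) = MvPolynomial.map f (homogeneousComponent a G) := by
  classical
  refine MvPolynomial.ext _ _ fun m => ?_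
  rw [coeff_homogeneousComponent, coeff_map, coeff_map, coeff_homogeneousComponent]
  split_ifs <;> simp

omit hp [CharP k p] in
/-- `𝔩_e(𝔭)` is a homogeneous ideal (generated by linear forms). [folklore] -/
theorem isHomogeneousIdeal_linHullIdeal : IsHomogeneousIdeal (linHullIdeal k p 𝔭 e) := by
  unfold linHullIdeal
  refine isHomogeneousIdeal_span_of_isHomogeneous ?_
  rintro _ ⟨g, -, rfl⟩
  exact ⟨1, isHomogeneous_linForm g⟩

/-- **`𝔮_e(𝔭)` is a point of `ℙ^n_k`** (prime, homogeneous, not containing `S_+`) when `𝔭` is.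
[cite: Mizutani1973HironakaGroupSchemes, §1 (d)] -/
theorem isPoint_frobGen (hP : IsPoint k 𝔭) : IsPoint k (frobGen k p 𝔭 e) := by
  haveI := hP.1
  refine ⟨isPrime_frobGen k p 𝔭 e, fun f hf d => ?_, fun hle => hP.2.2 (hle.trans (frobGen_le k p 𝔭 e))⟩
  rw [mem_frobGen_iff] at hf ⊢
  rw [← homogeneousComponent_map']
  exact isHomogeneousIdeal_linHullIdeal k p 𝔭 e _ hf d

/-- **THE SAME HIRONAKA SCHEME**: `U_+(𝔮_e(𝔭))S = U_+(𝔭)S` — `B_{P,𝔮_e(𝔭)} = B_{P,𝔭}` — whenever `exponent B(𝔭) ≤ e`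
(generation by additive forms `Hironaka1970_thm1_cor_holds`, Oda's equality `hirForms_eq_invForms`, and
`invForms_frobGen_eq`).  So every Hironaka scheme of exponent `≤ e` is the scheme of a `q`-linear point, and `B(𝔭)` only
depends on the `k`-linear hull of `[ξ_0^q : ⋯ : ξ_n^q]`. [cite: Mizutani1973HironakaGroupSchemes, §1 (d) and Thm. 1.3; Oda1983HironakaGroupSchemeII, Thm. 3.1 (p. 1173: "a versal family")] -/
theorem bIdeal_frobGen_eq [𝔭.IsPrime] (hP : IsPoint k 𝔭) (hE : ExponentLE k p 𝔭 e) :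
    (haveI := isPrime_frobGen k p 𝔭 e; bIdeal k (frobGen k p 𝔭 e)) = bIdeal k 𝔭 := by
  haveI := isPrime_frobGen k p 𝔭 e
  rw [bIdeal_eq_famIdeal_hirForms_holds k p _ (isPoint_frobGen k p 𝔭 e hP), bIdeal_eq_famIdeal_hirForms_holds k p 𝔭 hP]
  have h : hirForms k p (frobGen k p 𝔭 e) = hirForms k p 𝔭 := by
    funext j
    rw [hirForms_eq_invForms _ j, hirForms_eq_invForms 𝔭 j, invForms_frobGen_eq k p 𝔭 e hE j]
  rw [h]

/-- In particular at `e = exponent B(𝔭)`: `B_{P,𝔮(𝔭)} = B_{P,𝔭}` for the `p^{exponent}`-linear generization `𝔮(𝔭) ⊆ 𝔭`.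
[cite: Mizutani1973HironakaGroupSchemes, §1 (d) and Thm. 1.3] -/
theorem bIdeal_frobGen_exponent_eq [𝔭.IsPrime] (hP : IsPoint k 𝔭) :
    (haveI := isPrime_frobGen k p 𝔭 (exponent k p 𝔭); bIdeal k (frobGen k p 𝔭 (exponent k p 𝔭))) = bIdeal k 𝔭 :=
  bIdeal_frobGen_eq k p 𝔭 _ hP (exponentLE_exponent k p 𝔭)

end FrobGen

end Summit.ResolutionOfSingularities.KangarooAtlas.Mizutani

end
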